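import Literature.Topology.FourManifolds.SPC4HandlesLemma2Leaves
import Literature.Topology.FourManifolds.SPC4HandlesSymmLeaves
import Literature.Topology.FourManifolds.HCobordismLevelDeformationProof
import HarnessLib

/-!
# The normal form `(1, k)` of a compact connected `4`-dimensional `1`-handlebody (NORM),
# discharged, and the Laudenbach–Poénaru facts from the remaining leaves

Topic `Literature/Topology/FourManifolds`; fact seat
`provefact-Literature.Topology.FourManifolds.lauden-f709dd520c` (on **h₁**,
`Literature.Topology.FourManifolds.laudenbachPoenaru_exists_diffeoExtends_mapOfEq_eq`,
Laudenbach–Poénaru, Bull. SMF 100 (1972), §2, Lemma 2).  Everything here is **proved**; no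
definition and no named fact is introduced.

* `exists_hasHandleDecomposition_handleCount_one_holds` — **discharge of NORM**
  (`Literature.Topology.FourManifolds.exists_hasHandleDecomposition_handleCount_one`,
  `SPC4HandlesModelReduction.lean`): *a compact connected smooth `4`-manifold with boundary which
  is a handlebody with handles of index `≤ 1` has a handle decomposition with exactly one
  `0`-handle, `k` `1`-handles for some `k`, and no handles of index `2` or `3`* (Juhász,
  *Differential and Low-Dimensional Topology* (2023), §6.1, the normal form `♮k S¹ × B³`; proof
  of Thm. 2.7, Step 1: superfluous `0`-handles are cancelled against `1`-handles, the
  cancellation being Milnor's First Cancellation Theorem 5.4 as used in the proof of Thm. 8.1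
  Index 0).  The tree had reduced NORM to the one leaf of Milnor's proof DAG of Thm. 5.4 that was
  still a named fact, the deformation of the level diffeomorphism `h` in the general case of
  Assertion 6 (`exists_hasHandleDecomposition_handleCount_one_of_levelDeformation`,
  `SPC4HandlesNormalFormProofs.lean`); that leaf is now the theorem
  `Cobordism.Milnor1965_cancellation_levelDeformation_holds` (`HCobordismLevelDeformationProof.lean`),
  and the discharge is the composition of the two.
* `laudenbachPoenaru_exists_diffeoExtends_mapOfEq_eq_of_oneHandle_of_realise` — **h₁ from its
  two remaining leaves**: the uniqueness of attaching one `1`-handle L1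
  (`oneHandle_nonempty_diffeomorph`; Kosinski (1993), VI (6.6), (11.4)(c)) and the realisation
  REALISE of the paper's diffeomorphisms `H₁, H₂, H₃` on the model
  (`exists_oneHandlebody_realise_laudenbachPoenaruGenerators`; Laudenbach–Poénaru (1972), proof
  of Lemma 2, pp. 339–340), by
  `laudenbachPoenaru_exists_diffeoExtends_mapOfEq_eq_of_norm_of_oneHandle_of_realise`
  (`SPC4HandlesLemma2Leaves.lean`).  The discharge
  `laudenbachPoenaru_exists_diffeoExtends_mapOfEq_eq_holds` is this theorem applied to
  `oneHandle_nonempty_diffeomorph_holds` and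
  `exists_oneHandlebody_realise_laudenbachPoenaruGenerators_holds`, once those land.
* `exists_diffeoExtends_isOrientationReversing_of_oneHandle` — likewise **h₃**
  (`exists_diffeoExtends_isOrientationReversing`, the orientation-reversing `π₁`-trivial
  extendable boundary diffeomorphism; Laudenbach–Poénaru (1972), §2, p. 342, diagram (5)) **from
  L1 alone**, by `exists_diffeoExtends_isOrientationReversing_of_norm_of_oneHandle`
  (`SPC4HandlesSymmLeaves.lean`).
* `exists_diffeomorph_comp_incl_eq_of_three_leaves` — and the extension theorem itself
  (`exists_diffeomorph_comp_incl_eq`, `SPC4Handles.lean` (c): every self-diffeomorphism of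
  `∂V` extends over `V`) from L1, REALISE and the orientation-preserving case THMAᴹ of Thm. A
  on the model (`exists_oneHandlebody_laudenbachPoenaru_diffeoExtends_of_isOrientationPreserving`),
  by `exists_diffeomorph_comp_incl_eq_of_model'` (`SPC4HandlesSymmHolds.lean`) with UNIQ₄ from
  L1 and LEMMA2ᴹ from Nielsen's theorem (discharged) and REALISE.

## References

* A. Juhász, *Differential and Low-Dimensional Topology*, LMS Student Texts 104 (2023): §6.1;
  proof of Thm. 2.7, Step 1; §1.7.  Held:
  `lit read book:juhasz2023-differential-low-dimensional-topology`. [Juhasz2023]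
* J. Milnor, *Lectures on the h-cobordism theorem*, notes by L. Siebenmann and J. Sondow,
  Princeton Mathematical Notes (1965): Thm. 5.4 and its proof, Assertion 6 (PDF pp. 27–32);
  proof of Thm. 8.1 Index 0 (PDF p. 54).  Held:
  `lit read book:milnornd-lectures-h-cobordism-theorem`. [MilnorHCobordism1965]
* F. Laudenbach, V. Poénaru, *A note on 4-dimensional handlebodies*, Bull. Soc. Math. France
  100 (1972), 337–344: §2, Lemma 2 (pp. 339–340), proof of Thm. A (pp. 341–342).  Held:
  `lit read doi-10-24033-bsmf-1741`. [LaudenbachPoenaruBSMF1972]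
* A. A. Kosinski, *Differential Manifolds*, Academic Press (1993), VI (6.6), §11, (11.4)(c).
  [Kosinski1993]
-/

open scoped Manifold ContDiff Topology
open Set Function

noncomputable section

namespace Literature.Topology.FourManifolds

universe u

/-- **NORM, discharged: a compact connected `4`-dimensional `1`-handlebody has a handle
decomposition with one `0`-handle, `k` `1`-handles and no other handles**
(`exists_hasHandleDecomposition_handleCount_one`; Juhász (2023), §6.1 and proof of Thm. 2.7,
Step 1, the cancellation of superfluous `0`-handles being Milnor's Thm. 5.4 as in the proof of
Thm. 8.1 Index 0) — `exists_hasHandleDecomposition_handleCount_one_of_levelDeformation` applied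
to `Cobordism.Milnor1965_cancellation_levelDeformation_holds`.
[cite: Juhasz2023, §6.1 and proof of Thm. 2.7, Step 1]
[cite: MilnorHCobordism1965, Thm. 5.4 and its proof, Assertion 6 (PDF pp. 27–32); proof of Thm. 8.1 Index 0 (PDF p. 54)] -/
theorem exists_hasHandleDecomposition_handleCount_one_holds :
    exists_hasHandleDecomposition_handleCount_one.{u} :=
  exists_hasHandleDecomposition_handleCount_one_of_levelDeformation
    Cobordism.Milnor1965_cancellation_levelDeformation_holds

/-- **h₁ from its two remaining leaves, L1 and REALISE**: Laudenbach–Poénaru's Lemma 2 for every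
compact connected orientable `4`-dimensional `1`-handlebody
(`laudenbachPoenaru_exists_diffeoExtends_mapOfEq_eq`) follows from the uniqueness of attaching
one `1`-handle (`oneHandle_nonempty_diffeomorph`) and the realisation of `Φ₁, Φ₂, Φ₃` on the
model (`exists_oneHandlebody_realise_laudenbachPoenaruGenerators`), NORM and Nielsen's theorem
being discharged.
[cite: LaudenbachPoenaruBSMF1972, §2, Lemma 2 and its proof (pp. 339–340)]
[cite: Kosinski1993, VI (6.6), (11.4)(c)] -/
theorem laudenbachPoenaru_exists_diffeoExtends_mapOfEq_eq_of_oneHandle_of_realise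
    (hL : oneHandle_nonempty_diffeomorph.{u})
    (hR : exists_oneHandlebody_realise_laudenbachPoenaruGenerators.{u}) :
    laudenbachPoenaru_exists_diffeoExtends_mapOfEq_eq.{u} :=
  laudenbachPoenaru_exists_diffeoExtends_mapOfEq_eq_of_norm_of_oneHandle_of_realise
    exists_hasHandleDecomposition_handleCount_one_holds hL hR

/-- **h₃ from L1 alone**: the orientation-reversing, `π₁`-trivial, extendable boundary
diffeomorphism of every compact connected orientable `4`-dimensional `1`-handlebody
(`exists_diffeoExtends_isOrientationReversing`; Laudenbach–Poénaru (1972), §2, p. 342,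
diagram (5)) follows from the uniqueness of attaching one `1`-handle
(`oneHandle_nonempty_diffeomorph`), NORM and SYMMᴹ being discharged.
[cite: LaudenbachPoenaruBSMF1972, §2, p. 342, diagram (5)] [cite: Kosinski1993, VI (11.4)(c)] -/
theorem exists_diffeoExtends_isOrientationReversing_of_oneHandle
    (hL : oneHandle_nonempty_diffeomorph.{u}) :
    exists_diffeoExtends_isOrientationReversing.{u} :=
  exists_diffeoExtends_isOrientationReversing_of_norm_of_oneHandle
    exists_hasHandleDecomposition_handleCount_one_holds hL

/-- **Laudenbach–Poénaru's extension theorem from its three remaining leaves**: every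
self-diffeomorphism of the boundary of a compact connected orientable `4`-dimensional
`1`-handlebody extends over it (`exists_diffeomorph_comp_incl_eq`; Laudenbach–Poénaru (1972),
Thm. A in extension form, p. 342), granted L1 (`oneHandle_nonempty_diffeomorph`), REALISE
(`exists_oneHandlebody_realise_laudenbachPoenaruGenerators`) and the orientation-preserving case
of Thm. A on the model
(`exists_oneHandlebody_laudenbachPoenaru_diffeoExtends_of_isOrientationPreserving`) — by
`exists_diffeomorph_comp_incl_eq_of_model'` with NORM, SYMMᴹ and Nielsen's theorem discharged.
[cite: LaudenbachPoenaruBSMF1972, §2, Lemma 2 and proof of Thm. A (pp. 339–342)]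
[cite: Kosinski1993, VI (6.6), (11.4)(c)] -/
theorem exists_diffeomorph_comp_incl_eq_of_three_leaves
    (hL : oneHandle_nonempty_diffeomorph.{u})
    (hR : exists_oneHandlebody_realise_laudenbachPoenaruGenerators.{u})
    (hA : exists_oneHandlebody_laudenbachPoenaru_diffeoExtends_of_isOrientationPreserving.{u}) :
    exists_diffeomorph_comp_incl_eq.{u} :=
  exists_diffeomorph_comp_incl_eq_of_model' exists_hasHandleDecomposition_handleCount_one_holds
    (nonempty_diffeomorph_of_hasHandleDecomposition_handleCount_one_of_oneHandle hL)
    (exists_oneHandlebody_laudenbachPoenaru_exists_diffeoExtends_mapOfEq_eq_of_nielsen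
      autFreeGroup_eq_closure_nielsen_holds hR) hA

end Literature.Topology.FourManifolds

end
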